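import Literature.MathematicalPhysics.QuantumLattice.HubbardProjectedCreationCommutator
import HarnessLib

/-!
# Coupling-independent one-particle costs for the REPULSIVE Hubbard model (projected trial states)

Topic `MathematicalPhysics/QuantumLattice` (family `hubbard`); proof-only.  Part 2 of 3 (part 1:
`HubbardProjectedCreationCommutator`, part 3: `HubbardParityGapCeilingStrongCoupling`), written for route
`HubbardSuperconductivity/ParityGapRigidity` (crux `GappedWindow`, stmt-HubbardSuperconductivity-2196, kill
criterion `NoUniformParityGap`, stmt-…-2198).  For an eigenvector `Hχ = Eχ` of the Hubbard Hamiltonian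
`H = hamiltonian G t U` on a graph of maximal degree `≤ Δ`, `χ` a unit `N`-particle vector:

* `groundEnergy_succ_le_projected` — **particle addition, ANY real `U`, below half filling** (`N < |Λ|`):
  `E(N+1) ≤ E + 3Δ|t|·√|Λ|/√(|Λ| - N)`.  The `|Λ|` projected trial vectors `φ_z = (1 - n_{z↓})c†_{z↑}χ`
  lie in the `(N+1)`-sector, `Hφ_z = Eφ_z + [H, (1-n_{z↓})c†_{z↑}]χ` with a commutator of norm `≤ 3Δ|t|`
  containing no `U` (part 1), and their total weight `Σ_z ‖φ_z‖² = ⟨#empty sites⟩ ≥ |Λ| - N`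
  (`card_sub_le_sum_star_projCreation_mulVec_dotProduct`); average the variational bound over `z`
  (Cauchy–Schwarz `Σ‖φ_z‖ ≤ √|Λ| √Σ‖φ_z‖²`);
* `exists_annihilation_rayleigh_le_of_nonneg`, `groundEnergy_pred_le_of_nonneg` — **particle removal,
  `U ≥ 0`**: `[H, c_{zτ}] = tΣ_{x∼z}c_{xτ} - U n_{zτ'}c_{zτ}` and `-U⟨c_zχ, n_{zτ'}c_zχ⟩ ≤ 0`, so
  removing an electron never raises the repulsion; at the best site `E(N-1) ≤ E + Δ|t|` (`N ≥ 1`),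
  uniformly in the filling AND the coupling (compare `exists_annihilation_rayleigh_le`: `Δ|t| + |U|`).

So below half filling both one-particle costs about ANY eigenvector of the repulsive model are bounded by
hopping data alone.  (A Summits-side relative for the pair chemical potential, `E(N) - E(N-2) ≤ 144|t|/√δ`,
is `Theorems/LiebTwinNoOnsiteODLRO{ProjectedAddition,KineticPairWindow}`.)  Everything is proved; no
definitions, no named facts.  Sources: H. Tasaki, *Physics and Mathematics of Quantum Many-Body Systems*
(2020) §2.1 (variational principle), §9.3, §11.2; D. Ruelle, *Statistical Mechanics: Rigorous Results*
(1969) §3.4 (a-priori density bounds, classical analogue); W. F. Brinkman, T. M. Rice, Phys. Rev. B 2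
(1970) 4302 §II.  Folklore finite-dimensional statements.

## Mathlib / tree search

Tree (REUSED): part 1; `re_expect_le_of_split`, `norm_toLp_sum_ite_adj_le`,
`norm_star_dotProduct_le_norm_toLp` (`HubbardUniformOneParticleCost`); `norm_toLp_sq`,
`ThermodynamicLimit.norm_star_dotProduct_mulVec_le`, `sum_star_annihilation_mulVec_dotProduct`,
`star_dotProduct_self_eq_re` (`HubbardOneParticleCost`); `numberAt_eq_diagonal`,
`annihilation_mul_number_of_ne`, `IsNParticle.creation_mulVec_holds`, `IsNParticle.annihilation_mulVec_holds`,
`LiebThm1.groundEnergy_mul_norm_le`, `dotProduct_creation_mul_annihilation_mulVec`.  Mathlib: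
`Finset.sum_mul_sq_le_sq_mul_sq`, `Real.sqrt_le_sqrt`, `Real.mul_self_sqrt`, `Finset.exists_max_image`.
-/

noncomputable section

namespace Literature.MathematicalPhysics.QuantumLattice

open Matrix Finset HubbardWave0 ThermodynamicLimit
open scoped ComplexOrder Matrix.Norms.L2Operator InnerProductSpace

variable {Λ : Type*} [LinearOrder Λ] [Fintype Λ] (G : SimpleGraph Λ) [DecidableRel G.Adj]

/-! ### Bookkeeping: projected trial vectors -/

omit [LinearOrder Λ] in
/-- Sums over orbitals are sums over sites and spins. [folklore] -/
private theorem sum_orb_eq' {M : Type*} [AddCommMonoid M] (f : Orb Λ → M) :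
    ∑ p, f p = ∑ x : Λ, ∑ σ : Fin 2, f (orb x σ) := by
  rw [← Fintype.sum_prod_type', ← (toLex : Λ × Fin 2 ≃ Orb Λ).sum_comp]

/-- Number operators preserve the particle number. [folklore] -/
theorem IsNParticle.numberOp_mulVec {N : ℕ} {ψ : Fock (Orb Λ)} (hψ : IsNParticle N ψ) (z : Λ)
    (σ : Fin 2) : IsNParticle N (numberOp z σ *ᵥ ψ) := by
  intro s hs
  rw [← numberAt_orb, numberAt_eq_diagonal, mulVec_diagonal, hψ s hs, mul_zero]

/-- The projected creation `(1 - n_{zσ'}) c†_{zσ}` maps `N`-particle vectors to `(N+1)`-particle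
vectors. [folklore] -/
theorem IsNParticle.projCreation_mulVec {N : ℕ} {ψ : Fock (Orb Λ)} (hψ : IsNParticle N ψ) (z : Λ)
    (σ σ' : Fin 2) : IsNParticle (N + 1) (((1 - numberOp z σ') * creation (orb z σ)) *ᵥ ψ) := by
  intro s hs
  have h1 : IsNParticle (N + 1) (creation (orb z σ) *ᵥ ψ) := IsNParticle.creation_mulVec_holds hψ _
  rw [← mulVec_mulVec, sub_mulVec, one_mulVec, Pi.sub_apply, h1 s hs,
    (IsNParticle.numberOp_mulVec h1 z σ') s hs, sub_zero]

/-- `⟨χ, n_i n_j χ⟩ ≥ 0`: a product of number operators is a diagonal `0/1` matrix. [folklore] -/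
theorem re_dotProduct_numberAt_mul_numberAt_mulVec_nonneg (i j : Orb Λ) (χ : Fock (Orb Λ)) :
    0 ≤ (star χ ⬝ᵥ ((numberAt i * numberAt j) *ᵥ χ)).re := by
  rw [numberAt_eq_diagonal, numberAt_eq_diagonal, diagonal_mul_diagonal, dotProduct, Complex.re_sum]
  refine Finset.sum_nonneg fun s _ => ?_
  have hz : 0 ≤ (star (χ s) * χ s).re := by
    rw [Complex.star_def, Complex.conj_mul', ← Complex.ofReal_pow, Complex.ofReal_re]; positivity
  rw [mulVec_diagonal, Pi.star_apply]
  split_ifs <;> simp only [mul_one, mul_zero, zero_mul, one_mul, Complex.zero_re, le_refl, hz]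

/-- **Weight of the projected trial vector**: `‖(1 - n_{z↓}) c†_{z↑} χ‖² = ⟨χ, (1 - n_{z↑})(1 - n_{z↓}) χ⟩
= ⟨χ,χ⟩ - ⟨n_{z↑}⟩ - ⟨n_{z↓}⟩ + ⟨n_{z↓} n_{z↑}⟩` (CAR: `c (1-n')² c† = (1-n')(1-n)`).
Bratteli–Robinson II §5.2.2. [folklore] -/
theorem star_projCreation_mulVec_dotProduct (z : Λ) (χ : Fock (Orb Λ)) :
    star (((1 - numberOp z 1) * creation (orb z 0)) *ᵥ χ) ⬝ᵥ
        (((1 - numberOp z 1) * creation (orb z 0)) *ᵥ χ) =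
      star χ ⬝ᵥ χ - star χ ⬝ᵥ (numberOp z 0 *ᵥ χ) - star χ ⬝ᵥ (numberOp z 1 *ᵥ χ) +
        star χ ⬝ᵥ ((numberOp z 1 * numberOp z 0) *ᵥ χ) := by
  set P : Matrix (Finset (Orb Λ)) (Finset (Orb Λ)) ℂ := 1 - numberOp z 1 with hP
  have hPh : Pᴴ = P := by
    rw [hP, conjTranspose_sub, conjTranspose_one, ← numberAt_orb,
      (numberAt_isHermitian (orb z 1)).eq]
  have hPP : P * P = P := by
    rw [hP, mul_sub, sub_mul, one_mul, mul_one, sub_mul, one_mul, ← numberAt_orb,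
      (numberAt_idempotent (orb z 1)).eq]
    abel
  have hne : orb z 1 ≠ orb z 0 := by simp
  have hcar := annihilation_mul_creation_add_creation_mul_annihilation_holds (ι := Orb Λ)
    (orb z 0) (orb z 0)
  rw [if_pos rfl] at hcar
  have hcc : annihilation (orb z 0) * creation (orb z 0) =
      (1 : Matrix (Finset (Orb Λ)) (Finset (Orb Λ)) ℂ) - numberOp z 0 := by
    rw [numberOp, ← hcar, add_sub_cancel_right]
  -- `Aᴴ A = (1 - n↓)(1 - n↑)`
  have hAA : (P * creation (orb z 0))ᴴ * (P * creation (orb z 0)) =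
      1 - numberOp z 0 - numberOp z 1 + numberOp z 1 * numberOp z 0 := by
    rw [conjTranspose_mul, creation_conjTranspose, hPh,
      show annihilation (orb z 0) * P * (P * creation (orb z 0)) =
        annihilation (orb z 0) * (P * P) * creation (orb z 0) by noncomm_ring, hPP, hP, mul_sub,
      mul_one, numberOp, annihilation_mul_number_of_ne hne, ← numberOp,
      show (annihilation (orb z 0) - numberOp z 1 * annihilation (orb z 0)) * creation (orb z 0) =
        (1 - numberOp z 1) * (annihilation (orb z 0) * creation (orb z 0)) by noncomm_ring, hcc]
    noncomm_ring
  rw [star_mulVec_dotProduct, mulVec_mulVec, hAA, add_mulVec, sub_mulVec, sub_mulVec, one_mulVec,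
    dotProduct_add, dotProduct_sub, dotProduct_sub]

/-- **Total weight of the projected trial vectors is at least the number of holes**:
`Σ_z ‖(1 - n_{z↓}) c†_{z↑} χ‖² ≥ |Λ| - N` for a unit `N`-particle vector (`Σ_z (n_{z↑} + n_{z↓}) = N`,
`n_{z↓}n_{z↑} ≥ 0`). Bratteli–Robinson II §5.2.2. [folklore] -/
theorem card_sub_le_sum_star_projCreation_mulVec_dotProduct {N : ℕ} {χ : Fock (Orb Λ)}
    (hN : IsNParticle N χ) (h1 : star χ ⬝ᵥ χ = 1) :
    (Fintype.card Λ : ℝ) - N ≤ ∑ z : Λ, (star (((1 - numberOp z 1) * creation (orb z 0)) *ᵥ χ) ⬝ᵥ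
        (((1 - numberOp z 1) * creation (orb z 0)) *ᵥ χ)).re := by
  have hocc : ∑ z : Λ, ((star χ ⬝ᵥ (numberOp z 0 *ᵥ χ)).re + (star χ ⬝ᵥ (numberOp z 1 *ᵥ χ)).re) = N := by
    have h := congrArg Complex.re (sum_star_annihilation_mulVec_dotProduct hN h1)
    rw [Complex.re_sum, sum_orb_eq'] at h
    simp only [Fin.sum_univ_two] at h
    rw [Complex.natCast_re] at h
    rw [← h]
    refine Finset.sum_congr rfl fun z _ => ?_
    rw [numberOp, numberOp, dotProduct_creation_mul_annihilation_mulVec,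
      dotProduct_creation_mul_annihilation_mulVec]
  simp_rw [star_projCreation_mulVec_dotProduct, Complex.add_re, Complex.sub_re, h1, Complex.one_re]
  rw [Finset.sum_add_distrib, Finset.sum_sub_distrib, Finset.sum_sub_distrib, Finset.sum_const,
    Finset.card_univ, nsmul_eq_mul, mul_one, sub_sub, ← Finset.sum_add_distrib, hocc]
  have hD : 0 ≤ ∑ z : Λ, (star χ ⬝ᵥ ((numberOp z 1 * numberOp z 0) *ᵥ χ)).re :=
    Finset.sum_nonneg fun z _ => re_dotProduct_numberAt_mul_numberAt_mulVec_nonneg _ _ χ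
  linarith

/-! ### Particle addition at any coupling: projected trial states, averaged over the sites -/

/-- **Particle-addition cost, uniform in the coupling.** If `Hχ = Eχ` for the Hubbard Hamiltonian
`H = hamiltonian G t U` (ANY real `U`) on a graph of maximal degree `≤ Δ`, `χ` a unit `N`-particle vector
with `N < |Λ|`, then `E(N+1) ≤ E + 3Δ|t|·√|Λ|/√(|Λ| - N)`.  Proof: the `|Λ|` projected trial vectors
`φ_z = (1 - n_{z↓})c†_{z↑}χ` lie in the `(N+1)`-sector, `Hφ_z = Eφ_z + [H, (1-n_{z↓})c†_{z↑}]χ` with a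
commutator of norm `≤ 3Δ|t|` containing no `U` (`norm_commutator_hamiltonian_projCreation_up_le`), so
`E(N+1)‖φ_z‖² ≤ E‖φ_z‖² + 3Δ|t|‖φ_z‖`; sum over `z`, use `Σ‖φ_z‖² ≥ |Λ| - N` and Cauchy–Schwarz
`Σ‖φ_z‖ ≤ √|Λ|·√(Σ‖φ_z‖²)`.  Tasaki (2020) §2.1, §11.2; Brinkman–Rice (1970) §II. [folklore] -/
theorem groundEnergy_succ_le_projected {Δ : ℕ} (hΔ : ∀ x : Λ, #{y | G.Adj x y} ≤ Δ) (t U : ℝ) {N : ℕ}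
    {χ : Fock (Orb Λ)} (hN : IsNParticle N χ) (h1 : star χ ⬝ᵥ χ = 1) {E : ℝ}
    (hE : hamiltonian G t U *ᵥ χ = (E : ℂ) • χ) (hNΛ : N < Fintype.card Λ) :
    groundEnergy (hamiltonian G t U) (N + 1) ≤
      E + 3 * Δ * |t| * Real.sqrt (Fintype.card Λ) / Real.sqrt (Fintype.card Λ - N) := by
  classical
  set H := hamiltonian G t U with hH
  -- the trial-state split `H(Aχ) = E(Aχ) + [H, A]χ` (tree: `mulVec_mulVec_of_eigenvector`, Summits-side)
  have hsplit_gen : ∀ A : Matrix (Finset (Orb Λ)) (Finset (Orb Λ)) ℂ,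
      H *ᵥ (A *ᵥ χ) = (E : ℂ) • (A *ᵥ χ) + (H * A - A * H) *ᵥ χ := fun A => by
    rw [sub_mulVec, ← mulVec_mulVec, ← mulVec_mulVec, hE, mulVec_smul]; abel
  set E' := groundEnergy H (N + 1) with hE'
  set K : ℝ := 3 * Δ * |t| with hK
  set A : Λ → Matrix (Finset (Orb Λ)) (Finset (Orb Λ)) ℂ := fun z =>
    (1 - numberOp z 1) * creation (orb z 0) with hA
  set φ : Λ → Fock (Orb Λ) := fun z => A z *ᵥ χ with hφ
  set w : Λ → ℝ := fun z => (star (φ z) ⬝ᵥ φ z).re with hw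
  set W : ℝ := ∑ z, w z with hWdef
  have hK0 : 0 ≤ K := by positivity
  have hnormχ : ‖(WithLp.toLp 2 χ : EuclideanSpace ℂ (Finset (Orb Λ)))‖ = 1 := by
    have h := norm_toLp_sq χ
    rw [h1, Complex.one_re] at h
    rwa [pow_eq_one_iff_of_nonneg (norm_nonneg _) two_ne_zero] at h
  have hwnorm : ∀ z, w z = ‖(WithLp.toLp 2 (φ z) : EuclideanSpace ℂ (Finset (Orb Λ)))‖ ^ 2 :=
    fun z => (norm_toLp_sq (φ z)).symm
  have hw0 : ∀ z, 0 ≤ w z := fun z => by rw [hwnorm]; positivity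
  -- total weight
  have hW : (Fintype.card Λ : ℝ) - N ≤ W := card_sub_le_sum_star_projCreation_mulVec_dotProduct hN h1
  have hWpos : 0 < W := lt_of_lt_of_le (by
    have : (N : ℝ) < Fintype.card Λ := by exact_mod_cast hNΛ
    linarith) hW
  -- energy of each trial vector
  have hen : ∀ z, (star (φ z) ⬝ᵥ (H *ᵥ φ z)).re ≤
      E * w z + K * ‖(WithLp.toLp 2 (φ z) : EuclideanSpace ℂ (Finset (Orb Λ)))‖ := by
    intro z
    have hsplit : H *ᵥ φ z = (E : ℂ) • φ z + (H * A z - A z * H) *ᵥ χ := hsplit_gen (A z)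
    rw [hsplit, dotProduct_add, dotProduct_smul, smul_eq_mul, Complex.add_re, Complex.re_ofReal_mul,
      star_dotProduct_self_eq_re, Complex.ofReal_re]
    have hX : ‖star (φ z) ⬝ᵥ ((H * A z - A z * H) *ᵥ χ)‖ ≤
        K * ‖(WithLp.toLp 2 (φ z) : EuclideanSpace ℂ (Finset (Orb Λ)))‖ := by
      refine (ThermodynamicLimit.norm_star_dotProduct_mulVec_le _ _ _).trans ?_
      rw [hnormχ, mul_one, mul_comm]
      exact mul_le_mul_of_nonneg_right (norm_commutator_hamiltonian_projCreation_up_le G hΔ t U z)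
        (norm_nonneg _)
    have hX' := (Complex.re_le_norm _).trans hX
    change E * w z + _ ≤ _
    linarith
  -- variational bound on each trial vector, summed
  have hvar : ∀ z, E' * w z ≤ (star (φ z) ⬝ᵥ (H *ᵥ φ z)).re := fun z =>
    LiebThm1.groundEnergy_mul_norm_le H (IsNParticle.projCreation_mulVec hN z 0 1)
  have hsum : E' * W ≤ E * W + K * ∑ z, ‖(WithLp.toLp 2 (φ z) : EuclideanSpace ℂ (Finset (Orb Λ)))‖ := by
    have h := Finset.sum_le_sum fun z (_ : z ∈ Finset.univ) => (hvar z).trans (hen z)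
    rw [← Finset.mul_sum, Finset.sum_add_distrib, ← Finset.mul_sum, ← Finset.mul_sum] at h
    exact h
  -- Cauchy–Schwarz: `Σ ‖φ_z‖ ≤ √|Λ| √W`
  have hCS : ∑ z, ‖(WithLp.toLp 2 (φ z) : EuclideanSpace ℂ (Finset (Orb Λ)))‖ ≤
      Real.sqrt (Fintype.card Λ) * Real.sqrt W := by
    have h := Finset.sum_mul_sq_le_sq_mul_sq Finset.univ
      (fun z => ‖(WithLp.toLp 2 (φ z) : EuclideanSpace ℂ (Finset (Orb Λ)))‖) (fun _ => (1 : ℝ))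
    simp only [mul_one, one_pow, Finset.sum_const, Finset.card_univ, nsmul_eq_mul] at h
    rw [← Real.sqrt_mul (Nat.cast_nonneg _), ← Real.sqrt_sq (Finset.sum_nonneg fun z _ => norm_nonneg
      (WithLp.toLp 2 (φ z) : EuclideanSpace ℂ (Finset (Orb Λ))))]
    refine Real.sqrt_le_sqrt ?_
    calc (∑ z, ‖(WithLp.toLp 2 (φ z) : EuclideanSpace ℂ (Finset (Orb Λ)))‖) ^ 2
        ≤ (∑ z, ‖(WithLp.toLp 2 (φ z) : EuclideanSpace ℂ (Finset (Orb Λ)))‖ ^ 2) * (Fintype.card Λ : ℝ) := by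
          simpa [mul_comm] using h
      _ = (Fintype.card Λ : ℝ) * W := by
          rw [mul_comm, hWdef]
          simp only [hwnorm]
  -- conclude
  have hsW : 0 < Real.sqrt W := Real.sqrt_pos.2 hWpos
  have hsD : 0 < Real.sqrt (Fintype.card Λ - N) := Real.sqrt_pos.2 (by
    have : (N : ℝ) < Fintype.card Λ := by exact_mod_cast hNΛ
    linarith)
  have hgoal : (E' - E) * Real.sqrt W ≤ K * Real.sqrt (Fintype.card Λ) := by
    have h2 : (E' - E) * W ≤ K * (Real.sqrt (Fintype.card Λ) * Real.sqrt W) := by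
      have := mul_le_mul_of_nonneg_left hCS hK0
      linarith
    have hWsq : W = Real.sqrt W * Real.sqrt W := (Real.mul_self_sqrt hWpos.le).symm
    have h3 : ((E' - E) * Real.sqrt W) * Real.sqrt W ≤ (K * Real.sqrt (Fintype.card Λ)) * Real.sqrt W :=
      calc ((E' - E) * Real.sqrt W) * Real.sqrt W = (E' - E) * W := by rw [mul_assoc, ← hWsq]
        _ ≤ K * (Real.sqrt (Fintype.card Λ) * Real.sqrt W) := h2
        _ = (K * Real.sqrt (Fintype.card Λ)) * Real.sqrt W := by ring
    exact le_of_mul_le_mul_right h3 hsW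
  have hmono : (E' - E) * Real.sqrt (Fintype.card Λ - N) ≤ K * Real.sqrt (Fintype.card Λ) := by
    by_cases hpos : E' - E ≤ 0
    · exact (mul_nonpos_of_nonpos_of_nonneg hpos (Real.sqrt_nonneg _)).trans (by positivity)
    · push Not at hpos
      exact (mul_le_mul_of_nonneg_left (Real.sqrt_le_sqrt hW) hpos.le).trans hgoal
  rw [mul_comm] at hmono
  have := (le_div_iff₀' hsD).2 hmono
  rw [hK] at this
  linarith

/-! ### Particle removal for `U ≥ 0`: the best site, no interaction cost -/

omit [LinearOrder Λ] in
/-- Variational split with a dissipative remainder: if `Hφ = Eφ + w + w'` with `‖w‖ ≤ κ‖φ‖` and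
`Re⟨φ, w'⟩ ≤ 0` then `Re⟨φ, Hφ⟩ ≤ (E + κ)‖φ‖²`. Tasaki (2020) §2.1. [folklore] -/
theorem re_expect_le_of_split_of_re_nonpos [LinearOrder Λ] (H : Matrix (Finset (Orb Λ)) (Finset (Orb Λ)) ℂ)
    {φ w w' : Fock (Orb Λ)} {E κ : ℝ} (hsplit : H *ᵥ φ = (E : ℂ) • φ + w + w')
    (hw : ‖(WithLp.toLp 2 w : EuclideanSpace ℂ (Finset (Orb Λ)))‖ ≤
      κ * ‖(WithLp.toLp 2 φ : EuclideanSpace ℂ (Finset (Orb Λ)))‖)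
    (hw' : (star φ ⬝ᵥ w').re ≤ 0) :
    (expect H φ).re ≤ (E + κ) * (star φ ⬝ᵥ φ).re := by
  have hre : (star φ ⬝ᵥ φ).re = ‖(WithLp.toLp 2 φ : EuclideanSpace ℂ (Finset (Orb Λ)))‖ ^ 2 :=
    (norm_toLp_sq φ).symm
  rw [expect, hsplit, dotProduct_add, dotProduct_add, dotProduct_smul, smul_eq_mul, Complex.add_re,
    Complex.add_re, Complex.re_ofReal_mul, hre]
  have h1 : (star φ ⬝ᵥ w).re ≤ κ * ‖(WithLp.toLp 2 φ : EuclideanSpace ℂ (Finset (Orb Λ)))‖ ^ 2 :=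
    calc (star φ ⬝ᵥ w).re ≤ ‖star φ ⬝ᵥ w‖ := Complex.re_le_norm _
      _ ≤ ‖(WithLp.toLp 2 φ : EuclideanSpace ℂ (Finset (Orb Λ)))‖ *
            ‖(WithLp.toLp 2 w : EuclideanSpace ℂ (Finset (Orb Λ)))‖ := norm_star_dotProduct_le_norm_toLp φ w
      _ ≤ ‖(WithLp.toLp 2 φ : EuclideanSpace ℂ (Finset (Orb Λ)))‖ *
            (κ * ‖(WithLp.toLp 2 φ : EuclideanSpace ℂ (Finset (Orb Λ)))‖) :=
          mul_le_mul_of_nonneg_left hw (norm_nonneg _)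
      _ = κ * ‖(WithLp.toLp 2 φ : EuclideanSpace ℂ (Finset (Orb Λ)))‖ ^ 2 := by ring
  linarith

/-- **Particle removal never raises the repulsion (best site, `U ≥ 0`).** If `Hχ = Eχ` for the Hubbard
Hamiltonian with `U ≥ 0` on a graph of maximal degree `≤ Δ` and some `c_{zτ}χ ≠ 0`, then for the site
`z` maximising `‖c_{zτ}χ‖`, `φ = c_{zτ}χ ≠ 0` and `Re⟨φ, Hφ⟩ ≤ (E + Δ|t|)⟨φ, φ⟩`:
`[H, c_{zτ}] = tΣ_{x∼z}c_{xτ} - U n_{zτ'}c_{zτ}` and `-U⟨φ, n_{zτ'}φ⟩ = -U‖c_{zτ'}φ‖² ≤ 0`.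
(Compare `exists_annihilation_rayleigh_le`: cost `Δ|t| + |U|` for any sign of `U`.)
Tasaki (2020) §2.1, §9.3. [folklore] -/
theorem exists_annihilation_rayleigh_le_of_nonneg {Δ : ℕ} (hΔ : ∀ x : Λ, #{y | G.Adj x y} ≤ Δ)
    (t : ℝ) {U : ℝ} (hU : 0 ≤ U) {χ : Fock (Orb Λ)} {E : ℝ} (hχ : hamiltonian G t U *ᵥ χ = (E : ℂ) • χ)
    (τ : Fin 2) (hex : ∃ z, annihilation (orb z τ) *ᵥ χ ≠ 0) :
    ∃ z, annihilation (orb z τ) *ᵥ χ ≠ 0 ∧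
      (expect (hamiltonian G t U) (annihilation (orb z τ) *ᵥ χ)).re ≤
        (E + Δ * |t|) * (star (annihilation (orb z τ) *ᵥ χ) ⬝ᵥ (annihilation (orb z τ) *ᵥ χ)).re := by
  classical
  set H := hamiltonian G t U with hH
  set f : Λ → ℝ := fun x =>
    ‖(WithLp.toLp 2 (annihilation (orb x τ) *ᵥ χ) : EuclideanSpace ℂ (Finset (Orb Λ)))‖ with hf
  obtain ⟨z₀, hz₀⟩ := hex
  obtain ⟨z, -, hzmax⟩ := Finset.exists_max_image Finset.univ f ⟨z₀, Finset.mem_univ _⟩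
  have hfz₀ : 0 < f z₀ := by
    refine norm_pos_iff.2 fun h => hz₀ ?_
    have := congrArg WithLp.ofLp h
    simpa using this
  have hMpos : 0 < f z := lt_of_lt_of_le hfz₀ (hzmax z₀ (Finset.mem_univ _))
  have hφ0 : annihilation (orb z τ) *ᵥ χ ≠ 0 := by
    intro h
    have : f z = 0 := by simp [hf, h]
    rw [this] at hMpos
    exact lt_irrefl _ hMpos
  refine ⟨z, hφ0, ?_⟩
  obtain ⟨τ', -, hcommf⟩ := hamiltonian_mul_annihilation_sub G t U z τ
  set φ := annihilation (orb z τ) *ᵥ χ with hφ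
  have hsplit : H *ᵥ φ = (E : ℂ) • φ +
      ((t : ℂ) • (∑ x : Λ, if G.Adj x z then annihilation (orb x τ) else 0)) *ᵥ χ +
        (-((U : ℂ) • (numberOp z τ' *ᵥ φ))) := by
    have h0 : H *ᵥ φ = (E : ℂ) • φ + (H * annihilation (orb z τ) - annihilation (orb z τ) * H) *ᵥ χ := by
      rw [hφ, sub_mulVec, ← mulVec_mulVec, ← mulVec_mulVec, hχ, mulVec_smul]; abel
    rw [h0, hcommf, sub_mulVec, smul_mulVec (U : ℂ), ← mulVec_mulVec, ← hφ]
    abel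
  refine re_expect_le_of_split_of_re_nonpos H hsplit ?_ ?_
  · rw [smul_mulVec, Matrix.sum_mulVec, WithLp.toLp_smul]
    have hite : ∀ x : Λ, (if G.Adj x z then annihilation (orb x τ) else (0 : Matrix _ _ ℂ)) *ᵥ χ =
        if G.Adj x z then annihilation (orb x τ) *ᵥ χ else 0 := by
      intro x; split_ifs <;> simp
    simp only [hite]
    have h1 := norm_toLp_sum_ite_adj_le G hΔ z (fun x => annihilation (orb x τ) *ᵥ χ)
      (fun x => hzmax x (Finset.mem_univ _))
    calc ‖(t : ℂ) • (WithLp.toLp 2 (∑ x : Λ, if G.Adj x z then annihilation (orb x τ) *ᵥ χ else 0) :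
            EuclideanSpace ℂ (Finset (Orb Λ)))‖
        ≤ ‖(t : ℂ)‖ * ‖(WithLp.toLp 2 (∑ x : Λ, if G.Adj x z then annihilation (orb x τ) *ᵥ χ else 0) :
            EuclideanSpace ℂ (Finset (Orb Λ)))‖ := norm_smul_le _ _
      _ ≤ |t| * (Δ * f z) := by
          rw [Complex.norm_real, Real.norm_eq_abs]
          exact mul_le_mul_of_nonneg_left h1 (abs_nonneg _)
      _ = (Δ * |t|) * f z := by ring
  · rw [dotProduct_neg, dotProduct_smul, smul_eq_mul, Complex.neg_re, Complex.re_ofReal_mul, numberOp,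
      dotProduct_creation_mul_annihilation_mulVec, star_dotProduct_self_eq_re, Complex.ofReal_re]
    have h0 : 0 ≤ (star (annihilation (orb z τ') *ᵥ φ) ⬝ᵥ (annihilation (orb z τ') *ᵥ φ)).re := by
      rw [← norm_toLp_sq]; positivity
    nlinarith

/-- **Particle-removal cost for `U ≥ 0`, uniform in the coupling and in the filling.** If `Hχ = Eχ`
(`U ≥ 0`, maximal degree `≤ Δ`) for a unit `N`-particle `χ` with `N ≥ 1`, then `E(N-1) ≤ E + Δ|t|`.
Tasaki (2020) §2.1, §9.3. [folklore] -/
theorem groundEnergy_pred_le_of_nonneg {Δ : ℕ} (hΔ : ∀ x : Λ, #{y | G.Adj x y} ≤ Δ) (t : ℝ) {U : ℝ}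
    (hU : 0 ≤ U) {N : ℕ} {χ : Fock (Orb Λ)} (hN : IsNParticle N χ) (h1 : star χ ⬝ᵥ χ = 1)
    {E : ℝ} (hE : hamiltonian G t U *ᵥ χ = (E : ℂ) • χ) (hN1 : 1 ≤ N) :
    groundEnergy (hamiltonian G t U) (N - 1) ≤ E + Δ * |t| := by
  classical
  set H := hamiltonian G t U with hH
  -- some `c_{z↑} χ` or `c_{z↓} χ` is nonzero since `Σ ‖c_k χ‖² = N ≥ 1`
  obtain ⟨k, hk⟩ : ∃ k : Orb Λ, annihilation k *ᵥ χ ≠ 0 := by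
    by_contra hcon
    push Not at hcon
    have h := sum_star_annihilation_mulVec_dotProduct hN h1
    simp only [hcon, dotProduct_zero, Finset.sum_const_zero] at h
    have : (N : ℂ) = 0 := h.symm
    have hN0 : N = 0 := by exact_mod_cast this
    omega
  obtain ⟨z, hz, hray⟩ := exists_annihilation_rayleigh_le_of_nonneg G hΔ t hU hE (ofLex k).2
    ⟨(ofLex k).1, hk⟩
  set φ := annihilation (orb z (ofLex k).2) *ᵥ χ with hφ
  have hN' : IsNParticle (N - 1 + 1) χ := by rwa [Nat.sub_add_cancel hN1]
  have hφN : IsNParticle (N - 1) φ := IsNParticle.annihilation_mulVec_holds hN' _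
  have hvar := LiebThm1.groundEnergy_mul_norm_le H hφN
  have hφ2 : 0 < (star φ ⬝ᵥ φ).re := by
    have hpos : 0 < star φ ⬝ᵥ φ := dotProduct_star_self_pos_iff.2 hz
    exact (Complex.pos_iff.1 hpos).1
  exact le_of_mul_le_mul_right (hvar.trans hray) hφ2

end Literature.MathematicalPhysics.QuantumLattice
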